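import Mathlib
import Literature.Computability.Complexity.RandomKSatEnsembleOGP
import Summits.PneNP.PneNP.Theorems.OverlapGapAlgebraSearchHardWindowChainMassBasic
import Summits.PneNP.PneNP.Theorems.OverlapGapAlgebraSearchHardWindowResampleKernelBasic
import Summits.PneNP.PneNP.Theorems.OverlapGapAlgebraSearchHardWindowKernelSemigroup
import Summits.PneNP.PneNP.Theorems.OverlapGapAlgebraSearchHardWindowKernelPowPaths
import Summits.PneNP.PneNP.Theorems.OverlapGapAlgebraSearchHardWindowChainTwoBlock

/-!
# Route OverlapGapAlgebra, crux `SearchHardWindow` (stmt-PneNP-2460): finite-dimensional marginals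
# of the resampling chain

For the `ε`-resampling Markov chain `y 0, y 1, …, y K` on a finite product space `ι → Γ` started
uniformly (Huang–Sellke 2025 §3.3.2; vocabulary `resampleKernel`, `resampleChainMass` of
`Literature/Computability/Complexity/RandomKSatEnsembleOGP.lean`), `stub_multiTimeMarginal` computes
the mass of an event that reads the path only at monotone times `τ 0 ≤ τ 1 ≤ ⋯ ≤ τ L ≤ K`: it is
(bounded by, in fact equal to) the explicit `(L+1)`-fold sum
`(Σ_x ∏_{ℓ<L} P_{1−(1−ε)^{τ(ℓ+1)−τ ℓ}}(x ℓ, x (ℓ+1)) · [E x]) / #(ι → Γ)`,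
the gap kernels being the closed-form `Δ`-step kernels `P_{1−(1−ε)^Δ}` of the chain.

The proof is path-sum surgery for an abstract kernel `P` on a finite type `V` together with a family
`Q Δ` of "`Δ`-step kernels" characterised by `Q 0 = [u = v]` and `Q (Δ+1) = P ∘ Q Δ`
(for `P = P_ε` these are `Q Δ = P_{1−(1−ε)^Δ}`, by `kpp_resampleKernel_zero` and the semigroup
identity `stub_kernelSemigroup`). The Markov identity `mtm_marginal_abs`,
`Σ_y w(y) Φ (y 0) (ℓ ↦ y (τ ℓ))
  = Σ_v Σ_x Q (τ 0) v (x 0) · ∏_{ℓ<L} Q (τ(ℓ+1) − τ ℓ) (x ℓ) (x (ℓ+1)) · Φ v x`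
(`w(y) = ∏_{t<K} P (y t) (y (t+1))`), is proved by peeling the FIRST step of the path
(`ctb_sum_cons`, `ctb_weight_cons` of the two-block file), by induction on `L` and then on `τ 0`:
* `mtm_base` (`L = 0`, `τ 0 = 0`): the functional reads only `y 0`, all steps sum out (`ctb_total`,
  row-stochasticity);
* `mtm_collapse` (`τ 0 = 0`, `L + 1` observations): the observation vector is `Fin.cons (y 0)` of
  the observations at `τ ∘ succ`, and on the other side `Q 0 = [· = ·]` collapses the first
  summation;
* `mtm_shift` (`τ 0 = s + 1`): peel `y = Fin.cons v z`; the observations of `y` at `τ` are those of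
  `z` at `τ − 1`, the factor `P v (z 0)` is absorbed into the functional, and on the other side
  `Σ_u P v u · Q s u = Q (s+1) v`.
Finally the uniform start is summed out by the column sums `Σ_v Q Δ v u = 1` (`mtm_colsum`, from the
column-stochasticity of `P`, i.e. symmetry + stochasticity of `P_ε`,
`stub_resampleKernelBasic`), and `min (τ ℓ) K = τ ℓ` identifies the `ℕ`-indexed event of
`resampleChainMass` with the `Fin`-indexed one.
-/

set_option linter.dupNamespace false -- `Summit.PneNP.PneNP.…`: summit = sub-problem

namespace Summit.PneNP.PneNP.Theorems

open Finset
open Literature.Computability.Complexity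
open scoped Classical

section AbstractKernel

variable {V : Type*}

/-- When `τ 0 = 0`, the vector of observations of a path `y` at the times `τ` is `Fin.cons (y 0)` of
the observations at the times `τ ∘ Fin.succ`. -/
theorem mtm_obs_cons {K L : ℕ} (τ : Fin (L + 1 + 1) → ℕ) (h0 : τ 0 = 0) (hK : ∀ ℓ, τ ℓ < K + 1)
    (y : Fin (K + 1) → V) :
    (fun ℓ => y ⟨τ ℓ, hK ℓ⟩) =
      Fin.cons (y 0) (fun ℓ : Fin (L + 1) => y ⟨τ ℓ.succ, hK ℓ.succ⟩) := by
  funext ℓ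
  refine Fin.cases ?_ (fun j => ?_) ℓ
  · simp only [Fin.cons_zero]
    exact congrArg y (Fin.ext (by simp only [Fin.val_zero, h0]))
  · simp only [Fin.cons_succ]

/-- When all times `τ ℓ ≥ 1`, the observations of the path `Fin.cons v z` at the times `τ` are the
observations of `z` at the times `τ − 1`. -/
theorem mtm_obs_shift {K L : ℕ} (τ : Fin (L + 1) → ℕ) (h1 : ∀ ℓ, 1 ≤ τ ℓ)
    (hK : ∀ ℓ, τ ℓ < K + 1 + 1) (hK' : ∀ ℓ, τ ℓ - 1 < K + 1) (v : V) (z : Fin (K + 1) → V) :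
    (fun ℓ => (Fin.cons v z : Fin (K + 1 + 1) → V) ⟨τ ℓ, hK ℓ⟩) = fun ℓ => z ⟨τ ℓ - 1, hK' ℓ⟩ := by
  funext ℓ
  have e : (⟨τ ℓ, hK ℓ⟩ : Fin (K + 1 + 1)) = Fin.succ ⟨τ ℓ - 1, hK' ℓ⟩ :=
    Fin.ext (by have := h1 ℓ; simp only [Fin.val_succ]; omega)
  rw [e, Fin.cons_succ]

/-- Splitting off the first factor of a gap-kernel product along `Fin.cons u x`:
`∏_{ℓ<L+1} Q (τ(ℓ+1) − τ ℓ) ((u, x) ℓ) ((u, x) (ℓ+1))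
  = Q (τ 1 − τ 0) u (x 0) · ∏_{ℓ<L} Q (τ(ℓ+2) − τ(ℓ+1)) (x ℓ) (x (ℓ+1))`. -/
theorem mtm_gapProd_cons (Q : ℕ → V → V → ℝ) (L : ℕ) (τ : Fin (L + 1 + 1) → ℕ) (u : V)
    (x : Fin (L + 1) → V) :
    ∏ ℓ : Fin (L + 1), Q (τ ℓ.succ - τ ℓ.castSucc)
        ((Fin.cons u x : Fin (L + 1 + 1) → V) ℓ.castSucc)
        ((Fin.cons u x : Fin (L + 1 + 1) → V) ℓ.succ) =
      Q (τ (Fin.succ 0) - τ 0) u (x 0) *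
        ∏ ℓ : Fin L, Q (τ ℓ.succ.succ - τ ℓ.castSucc.succ) (x ℓ.castSucc) (x ℓ.succ) := by
  rw [Fin.prod_univ_succ]
  simp only [Fin.castSucc_zero, Fin.cons_zero, Fin.cons_succ, Fin.castSucc_succ]

variable [Fintype V] [DecidableEq V]

/-- Column sums of the multi-step kernels: if `P` is column-stochastic, `Q 0 = [· = ·]` and
`Q (Δ+1) u v = Σ_w P u w · Q Δ w v`, then `Σ_u Q Δ u v = 1` for every `Δ`. -/
theorem mtm_colsum (P : V → V → ℝ) (hP2 : ∀ v, ∑ u, P u v = 1) (Q : ℕ → V → V → ℝ)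
    (hQ0 : ∀ u v, Q 0 u v = if u = v then 1 else 0)
    (hQs : ∀ Δ u v, Q (Δ + 1) u v = ∑ w, P u w * Q Δ w v) :
    ∀ (Δ : ℕ) (v : V), ∑ u, Q Δ u v = 1
  | 0, v => by simp [hQ0]
  | Δ + 1, v => by
    simp only [hQs]
    rw [Finset.sum_comm]
    simp only [← Finset.sum_mul, hP2, one_mul]
    exact mtm_colsum P hP2 Q hQ0 hQs Δ v

/-- Base case of the marginal identity (`L = 0`, `τ 0 = 0`): the functional reads only the starting
point, and all `K` steps sum out (`ctb_total`). -/
theorem mtm_base (P : V → V → ℝ) (hP1 : ∀ u, ∑ v, P u v = 1) (Q : ℕ → V → V → ℝ)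
    (hQ0 : ∀ u v, Q 0 u v = if u = v then 1 else 0) (K : ℕ) (τ : Fin (0 + 1) → ℕ)
    (h0 : τ 0 = 0) (hK : ∀ ℓ, τ ℓ < K + 1) (Φ : V → (Fin (0 + 1) → V) → ℝ) :
    ∑ y : Fin (K + 1) → V, (∏ t : Fin K, P (y t.castSucc) (y t.succ)) *
        Φ (y 0) (fun ℓ => y ⟨τ ℓ, hK ℓ⟩) =
      ∑ v, ∑ x : Fin (0 + 1) → V, Q 0 v (x 0) *
        (∏ ℓ : Fin 0, Q (τ ℓ.succ - τ ℓ.castSucc) (x ℓ.castSucc) (x ℓ.succ)) * Φ v x := by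
  have hℓ0 : ∀ ℓ : Fin (0 + 1), ℓ = 0 := fun ℓ =>
    Fin.ext (by have := ℓ.2; simp only [Fin.val_zero]; omega)
  have hobs : ∀ y : Fin (K + 1) → V, (fun ℓ => y ⟨τ ℓ, hK ℓ⟩) = fun _ => y 0 := fun y => by
    funext ℓ
    obtain rfl : ℓ = 0 := hℓ0 ℓ
    exact congrArg y (Fin.ext (by simp only [Fin.val_zero, h0]))
  have hcst : ∀ x : Fin (0 + 1) → V, (fun _ => x 0) = x := fun x =>
    funext fun ℓ => congrArg x (hℓ0 ℓ).symm
  calc ∑ y : Fin (K + 1) → V, (∏ t : Fin K, P (y t.castSucc) (y t.succ)) *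
        Φ (y 0) (fun ℓ => y ⟨τ ℓ, hK ℓ⟩)
      = ∑ y : Fin (K + 1) → V, Φ (y 0) (fun _ => y 0) *
          ∏ t : Fin K, P (y t.castSucc) (y t.succ) :=
        Finset.sum_congr rfl fun y _ => by rw [hobs y, mul_comm]
    _ = ∑ v, Φ v (fun _ => v) := ctb_total P hP1 K (fun v => Φ v (fun _ => v))
    _ = ∑ x : Fin (0 + 1) → V, Φ (x 0) (fun _ => x 0) *
          ∏ t : Fin 0, P (x t.castSucc) (x t.succ) :=
        (ctb_total P hP1 0 (fun v => Φ v (fun _ => v))).symm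
    _ = _ := by
        rw [Finset.sum_comm]
        refine Finset.sum_congr rfl fun x _ => ?_
        rw [Fintype.sum_eq_single (x 0)]
        · rw [hQ0, if_pos rfl, hcst x]
          simp
        · intro v hv
          rw [hQ0, if_neg hv, zero_mul, zero_mul]

/-- Collapse step of the marginal identity (`τ 0 = 0`, `L + 1 + 1` observations): the observation
vector is `Fin.cons (y 0)` of the observations at `τ ∘ succ` (to which the identity with `L + 1`
observations applies), and on the other side the first kernel `Q 0 = [· = ·]` collapses the sum over
the first coordinate. -/
theorem mtm_collapse (P : V → V → ℝ) (Q : ℕ → V → V → ℝ)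
    (hQ0 : ∀ u v, Q 0 u v = if u = v then 1 else 0) (L : ℕ)
    (ih : ∀ (s K : ℕ) (τ : Fin (L + 1) → ℕ), Monotone τ → τ 0 = s → ∀ (hK : ∀ ℓ, τ ℓ < K + 1)
      (Φ : V → (Fin (L + 1) → V) → ℝ),
      ∑ y : Fin (K + 1) → V, (∏ t : Fin K, P (y t.castSucc) (y t.succ)) *
          Φ (y 0) (fun ℓ => y ⟨τ ℓ, hK ℓ⟩) =
        ∑ v, ∑ x : Fin (L + 1) → V, Q s v (x 0) *
          (∏ ℓ : Fin L, Q (τ ℓ.succ - τ ℓ.castSucc) (x ℓ.castSucc) (x ℓ.succ)) * Φ v x)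
    (K : ℕ) (τ : Fin (L + 1 + 1) → ℕ) (hτ : Monotone τ) (h0 : τ 0 = 0)
    (hK : ∀ ℓ, τ ℓ < K + 1) (Φ : V → (Fin (L + 1 + 1) → V) → ℝ) :
    ∑ y : Fin (K + 1) → V, (∏ t : Fin K, P (y t.castSucc) (y t.succ)) *
        Φ (y 0) (fun ℓ => y ⟨τ ℓ, hK ℓ⟩) =
      ∑ v, ∑ x : Fin (L + 1 + 1) → V, Q 0 v (x 0) *
        (∏ ℓ : Fin (L + 1), Q (τ ℓ.succ - τ ℓ.castSucc) (x ℓ.castSucc) (x ℓ.succ)) * Φ v x := by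
  have hτ' : Monotone (fun ℓ : Fin (L + 1) => τ ℓ.succ) := fun a b hab =>
    hτ (Fin.succ_le_succ_iff.mpr hab)
  calc ∑ y : Fin (K + 1) → V, (∏ t : Fin K, P (y t.castSucc) (y t.succ)) *
        Φ (y 0) (fun ℓ => y ⟨τ ℓ, hK ℓ⟩)
      = ∑ y : Fin (K + 1) → V, (∏ t : Fin K, P (y t.castSucc) (y t.succ)) *
          Φ (y 0) (Fin.cons (y 0) (fun ℓ : Fin (L + 1) => y ⟨τ ℓ.succ, hK ℓ.succ⟩)) :=
        Finset.sum_congr rfl fun y _ => by rw [mtm_obs_cons τ h0 hK y]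
    _ = ∑ v, ∑ x : Fin (L + 1) → V, Q (τ (Fin.succ 0)) v (x 0) *
          (∏ ℓ : Fin L, Q (τ ℓ.succ.succ - τ ℓ.castSucc.succ) (x ℓ.castSucc) (x ℓ.succ)) *
            Φ v (Fin.cons v x) :=
        ih (τ (Fin.succ 0)) K (fun ℓ => τ ℓ.succ) hτ' rfl (fun ℓ => hK ℓ.succ)
          (fun v x => Φ v (Fin.cons v x))
    _ = _ := by
        refine Finset.sum_congr rfl fun v _ => ?_
        symm
        rw [ctb_sum_cons (L + 1), Fintype.sum_eq_single v]
        · refine Finset.sum_congr rfl fun x _ => ?_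
          rw [Fin.cons_zero, hQ0, if_pos rfl, one_mul, mtm_gapProd_cons Q L τ v x, h0,
            Nat.sub_zero]
        · intro u hu
          exact Finset.sum_eq_zero fun x _ => by
            rw [Fin.cons_zero, hQ0, if_neg (Ne.symm hu), zero_mul, zero_mul]

omit [DecidableEq V] in
/-- Shift step of the marginal identity (`τ 0 = s + 1`): peel the first step of the path,
`y = Fin.cons v z` (`ctb_sum_cons`, `ctb_weight_cons`); the observations of `y` at `τ` are those of
`z` at `τ − 1`, the factor `P v (z 0)` is absorbed into the functional, the identity with `τ 0 = s`
applies, and `Σ_u P v u · Q s u (x 0) = Q (s+1) v (x 0)` reassembles the first kernel. -/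
theorem mtm_shift (P : V → V → ℝ) (Q : ℕ → V → V → ℝ)
    (hQs : ∀ Δ u v, Q (Δ + 1) u v = ∑ w, P u w * Q Δ w v) (L s : ℕ)
    (ih : ∀ (K : ℕ) (τ : Fin (L + 1) → ℕ), Monotone τ → τ 0 = s → ∀ (hK : ∀ ℓ, τ ℓ < K + 1)
      (Φ : V → (Fin (L + 1) → V) → ℝ),
      ∑ y : Fin (K + 1) → V, (∏ t : Fin K, P (y t.castSucc) (y t.succ)) *
          Φ (y 0) (fun ℓ => y ⟨τ ℓ, hK ℓ⟩) =
        ∑ v, ∑ x : Fin (L + 1) → V, Q s v (x 0) *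
          (∏ ℓ : Fin L, Q (τ ℓ.succ - τ ℓ.castSucc) (x ℓ.castSucc) (x ℓ.succ)) * Φ v x)
    (K : ℕ) (τ : Fin (L + 1) → ℕ) (hτ : Monotone τ) (h0 : τ 0 = s + 1)
    (hK : ∀ ℓ, τ ℓ < K + 1) (Φ : V → (Fin (L + 1) → V) → ℝ) :
    ∑ y : Fin (K + 1) → V, (∏ t : Fin K, P (y t.castSucc) (y t.succ)) *
        Φ (y 0) (fun ℓ => y ⟨τ ℓ, hK ℓ⟩) =
      ∑ v, ∑ x : Fin (L + 1) → V, Q (s + 1) v (x 0) *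
        (∏ ℓ : Fin L, Q (τ ℓ.succ - τ ℓ.castSucc) (x ℓ.castSucc) (x ℓ.succ)) * Φ v x := by
  have h1 : ∀ ℓ, 1 ≤ τ ℓ := fun ℓ => le_trans (by omega) (hτ (Fin.zero_le ℓ))
  obtain ⟨K', rfl⟩ : ∃ K', K = K' + 1 := ⟨K - 1, by have := hK 0; omega⟩
  have hK' : ∀ ℓ, τ ℓ - 1 < K' + 1 := fun ℓ => by have := hK ℓ; omega
  have hτ' : Monotone (fun ℓ => τ ℓ - 1) := fun a b hab => Nat.sub_le_sub_right (hτ hab) 1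
  have h0' : τ 0 - 1 = s := by omega
  have hgap : ∀ ℓ : Fin L, τ ℓ.succ - 1 - (τ ℓ.castSucc - 1) = τ ℓ.succ - τ ℓ.castSucc :=
    fun ℓ => by have := h1 ℓ.castSucc; omega
  calc ∑ y : Fin (K' + 1 + 1) → V, (∏ t : Fin (K' + 1), P (y t.castSucc) (y t.succ)) *
        Φ (y 0) (fun ℓ => y ⟨τ ℓ, hK ℓ⟩)
      = ∑ v, ∑ z : Fin (K' + 1) → V, (∏ t : Fin K', P (z t.castSucc) (z t.succ)) *
          (P v (z 0) * Φ v (fun ℓ => z ⟨τ ℓ - 1, hK' ℓ⟩)) := by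
        rw [ctb_sum_cons (K' + 1)]
        simp only [ctb_weight_cons, Fin.cons_zero]
        refine Finset.sum_congr rfl fun v _ => Finset.sum_congr rfl fun z _ => ?_
        rw [mtm_obs_shift τ h1 hK hK' v z]
        ring
    _ = ∑ v, ∑ u, ∑ x : Fin (L + 1) → V, Q s u (x 0) *
          (∏ ℓ : Fin L, Q (τ ℓ.succ - 1 - (τ ℓ.castSucc - 1)) (x ℓ.castSucc) (x ℓ.succ)) *
            (P v u * Φ v x) :=
        Finset.sum_congr rfl fun v _ =>
          ih K' (fun ℓ => τ ℓ - 1) hτ' h0' hK' (fun u x => P v u * Φ v x)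
    _ = _ := by
        refine Finset.sum_congr rfl fun v _ => ?_
        rw [Finset.sum_comm]
        refine Finset.sum_congr rfl fun x _ => ?_
        rw [hQs, Finset.sum_mul, Finset.sum_mul]
        refine Finset.sum_congr rfl fun u _ => ?_
        simp only [hgap]
        ring

/-- **The abstract multi-time marginal identity** (Markov property of the path sums). For a
row-stochastic kernel `P` and multi-step kernels `Q` with `Q 0 = [· = ·]`,
`Q (Δ+1) u v = Σ_w P u w · Q Δ w v`: for monotone times `τ 0 ≤ ⋯ ≤ τ L ≤ K` and any functional
`Φ` of the starting point and of the observations at the times `τ`,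
`Σ_y (∏_{t<K} P (y t) (y (t+1))) · Φ (y 0) (ℓ ↦ y (τ ℓ))
  = Σ_v Σ_x Q (τ 0) v (x 0) · (∏_{ℓ<L} Q (τ(ℓ+1) − τ ℓ) (x ℓ) (x (ℓ+1))) · Φ v x`.
Induction on `L`, then on `s = τ 0` (`mtm_base`, `mtm_collapse`, `mtm_shift`). -/
theorem mtm_marginal_abs (P : V → V → ℝ) (hP1 : ∀ u, ∑ v, P u v = 1) (Q : ℕ → V → V → ℝ)
    (hQ0 : ∀ u v, Q 0 u v = if u = v then 1 else 0)
    (hQs : ∀ Δ u v, Q (Δ + 1) u v = ∑ w, P u w * Q Δ w v) :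
    ∀ (L s K : ℕ) (τ : Fin (L + 1) → ℕ), Monotone τ → τ 0 = s → ∀ (hK : ∀ ℓ, τ ℓ < K + 1)
      (Φ : V → (Fin (L + 1) → V) → ℝ),
      ∑ y : Fin (K + 1) → V, (∏ t : Fin K, P (y t.castSucc) (y t.succ)) *
          Φ (y 0) (fun ℓ => y ⟨τ ℓ, hK ℓ⟩) =
        ∑ v, ∑ x : Fin (L + 1) → V, Q s v (x 0) *
          (∏ ℓ : Fin L, Q (τ ℓ.succ - τ ℓ.castSucc) (x ℓ.castSucc) (x ℓ.succ)) * Φ v x := by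
  intro L
  induction L with
  | zero =>
    intro s
    induction s with
    | zero => exact fun K τ _ h0 hK Φ => mtm_base P hP1 Q hQ0 K τ h0 hK Φ
    | succ s ih => exact mtm_shift P Q hQs 0 s ih
  | succ L ihL =>
    intro s
    induction s with
    | zero => exact fun K τ hτ h0 hK Φ => mtm_collapse P Q hQ0 L ihL K τ hτ h0 hK Φ
    | succ s ih => exact mtm_shift P Q hQs (L + 1) s ih

end AbstractKernel

/-- **Finite-dimensional marginals of the resampling chain** (Markov property + the closed-form
`Δ`-step kernel `P_{1−(1−ε)^Δ}` + stationarity of the uniform start; the bookkeeping behind the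
first moment of Huang–Sellke 2025, Lemma 3.22): for `0 ≤ ε ≤ 1` and times
`τ 0 ≤ τ 1 ≤ ⋯ ≤ τ L ≤ K`, the
mass of an event reading the path only at the times `τ ℓ` is at most (in fact equals) the explicit
`(L+1)`-fold sum `(Σ_x ∏_{ℓ<L} P_{1−(1−ε)^{τ(ℓ+1)−τ ℓ}}(x ℓ, x (ℓ+1)) · [E x]) / #(ι → Γ)`. -/
theorem stub_multiTimeMarginal {ι Γ : Type} [Fintype ι] [DecidableEq ι] [Fintype Γ] [DecidableEq Γ]
    [Nonempty Γ] (ε : ℝ) (hε0 : 0 ≤ ε) (hε1 : ε ≤ 1) (K L : ℕ) (τ : Fin (L + 1) → ℕ)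
    (hτ : Monotone τ) (hτK : τ (Fin.last L) ≤ K) (E : (Fin (L + 1) → ι → Γ) → Prop) :
    resampleChainMass ε K (fun z => E (fun ℓ => z (τ ℓ))) ≤
      (∑ x : Fin (L + 1) → ι → Γ,
        (∏ ℓ : Fin L, resampleKernel (1 - (1 - ε) ^ (τ ℓ.succ - τ ℓ.castSucc))
            (x ℓ.castSucc) (x ℓ.succ)) * (if E x then (1 : ℝ) else 0)) / Fintype.card (ι → Γ) := by
  have hB := stub_resampleKernelBasic (ι := ι) (Γ := Γ) ε hε0 hε1
  have hP1 : ∀ u : ι → Γ, ∑ v, resampleKernel ε u v = 1 := hB.2.2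
  have hP2 : ∀ v : ι → Γ, ∑ u, resampleKernel ε u v = 1 := fun v =>
    calc ∑ u, resampleKernel ε u v = ∑ u, resampleKernel ε v u :=
          Finset.sum_congr rfl fun u _ => hB.2.1 u v
      _ = 1 := hB.2.2 v
  have hQ0 : ∀ u v : ι → Γ, resampleKernel (1 - (1 - ε) ^ 0) u v = if u = v then 1 else 0 :=
    fun u v => by rw [pow_zero, sub_self, kpp_resampleKernel_zero]
  have hQs : ∀ (Δ : ℕ) (u v : ι → Γ), resampleKernel (1 - (1 - ε) ^ (Δ + 1)) u v =
      ∑ w, resampleKernel ε u w * resampleKernel (1 - (1 - ε) ^ Δ) w v := fun Δ u v => by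
    rw [stub_kernelSemigroup, sub_sub_cancel, pow_succ']
  have hτℓ : ∀ ℓ, τ ℓ ≤ K := fun ℓ => (hτ (Fin.le_last ℓ)).trans hτK
  have hKℓ : ∀ ℓ, τ ℓ < K + 1 := fun ℓ => Nat.lt_succ_of_le (hτℓ ℓ)
  have hcol : ∀ u : ι → Γ, ∑ v, resampleKernel (1 - (1 - ε) ^ τ 0) v u = 1 :=
    mtm_colsum (resampleKernel ε) hP2 (fun Δ => resampleKernel (1 - (1 - ε) ^ Δ)) hQ0 hQs (τ 0)
  have key := mtm_marginal_abs (resampleKernel ε) hP1 (fun Δ => resampleKernel (1 - (1 - ε) ^ Δ))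
    hQ0 hQs L (τ 0) K τ hτ rfl hKℓ (fun _ x => if E x then (1 : ℝ) else 0)
  unfold resampleChainMass
  refine div_le_div_of_nonneg_right (le_of_eq ?_) (Nat.cast_nonneg _)
  calc ∑ y : Fin (K + 1) → ι → Γ, (∏ t : Fin K, resampleKernel ε (y t.castSucc) (y t.succ)) *
        (if E (fun ℓ => y ⟨min (τ ℓ) K, Nat.lt_succ_of_le (Nat.min_le_right (τ ℓ) K)⟩)
          then (1 : ℝ) else 0)
      = ∑ y : Fin (K + 1) → ι → Γ, (∏ t : Fin K, resampleKernel ε (y t.castSucc) (y t.succ)) *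
          (if E (fun ℓ => y ⟨τ ℓ, hKℓ ℓ⟩) then (1 : ℝ) else 0) :=
        Finset.sum_congr rfl fun y _ => congrArg _ (cmb_ite_congr (Iff.of_eq (congrArg E
          (funext fun ℓ => congrArg y (Fin.ext (min_eq_left (hτℓ ℓ)))))))
    _ = ∑ v, ∑ x : Fin (L + 1) → ι → Γ, resampleKernel (1 - (1 - ε) ^ τ 0) v (x 0) *
          (∏ ℓ : Fin L, resampleKernel (1 - (1 - ε) ^ (τ ℓ.succ - τ ℓ.castSucc))
            (x ℓ.castSucc) (x ℓ.succ)) * (if E x then (1 : ℝ) else 0) := key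
    _ = ∑ x : Fin (L + 1) → ι → Γ,
          (∏ ℓ : Fin L, resampleKernel (1 - (1 - ε) ^ (τ ℓ.succ - τ ℓ.castSucc))
            (x ℓ.castSucc) (x ℓ.succ)) * (if E x then (1 : ℝ) else 0) := by
        rw [Finset.sum_comm]
        refine Finset.sum_congr rfl fun x _ => ?_
        rw [← Finset.sum_mul, ← Finset.sum_mul, hcol (x 0), one_mul]

end Summit.PneNP.PneNP.Theorems
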